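import Summits.QuantumFields.BalabanUV.T4Continuum.Support.BalabanMinimizerLaw

/-!
# T⁴ programme, spine node NE2 (U1a) — THE `U = 1` PLANTED LAW W.R.T. KING's PAIRING: `‖𝒢^{(η/R)} − J_R 𝒢^{(η)} J_Rᴴ‖ ≤
# (CQ + 4d·Cst)·η` for the piecewise-constant injection `J_R = R^{d/2}Q_Rᴴ`, its injected and complement defects, and the
# level-wise `U = 1` inputs of the background resolvent tower

Ninth generation of the NE2 prover lineage P1 of the cell `pub-balaban`, file 3 (the `U = 1` supplier of
`Spine/BackgroundResolventTower.FreeTowerLaws`).  The tree's `U = 1` two-level laws for Bałaban's `𝒢 = Δ_a⁻¹`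
([Balaban1984PropagatorsI] (1.71)/(1.83)) are the SANDWICHED King law `‖Q_R𝒢′Q_Rᴴ − R^{−d}𝒢‖ ≤ R^{−d}·CQ·η`
(`B5G183RateTorusW.opNorm_Qavg_calG_rate`, [King1986] (2.10)/(4.38) shape) and the PLANTED law w.r.t. the band-limited injection
(`B5G183RateTorus.opNorm_calG_rate`).  The background resolvent route (files 1–2 of this generation) wants the planted law w.r.t.
an injection `J` with `R^{d/2}Q_R·J = 1` EXACTLY — King's own pairing «When x′ ∈ T_{η′}, we denote by x that point in T_η for
which x′ ∈ B^n(x)» ([King1986] p. 664), i.e. the piecewise-constant isometric injection `J_R = R^{d/2}Q_Rᴴ`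
(`BalabanMinimizerLaw.Jpc` along the tower).  This file derives it from PUBLIC tree facts only:

 * §1 `JK N R M = R^{d/2}Q_Rᴴ` (two levels): `J_RᴴJ_R = 1`, `J_RJ_Rᴴ = Π` (the block-mean projector of `BalabanBlockPoincare`),
   `‖J_R‖ ≤ 1`, `R^{d/2}Q_RJ_R = 1` (pairing defect `F = 0`), `Πᴴ = Π`, `‖Π‖ ≤ 1`.
 * §2 the three pieces: `‖(1 − Π)𝒢′‖ ≤ 2d·Cst·η` (block Poincaré `BalabanBlockPoincare.opNorm_one_sub_Pi_mul_le` + the axis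
   defects from (1.89) `‖∇𝒢‖ ≤ Cst`, exactly as in `BalabanMinimizerLaw`), its adjoint `‖𝒢′(1 − Π)‖ ≤ 2d·Cst·η` (= the COMPLEMENT
   defect `e₀`), and `‖Π𝒢′Π − J_R𝒢J_Rᴴ‖ ≤ CQ·η` (= `J_R(R^dQ_R𝒢′Q_Rᴴ − 𝒢)J_Rᴴ`, the King law); whence **`opNorm_calG_sub_planted_le`**:
   `‖𝒢′ − J_R𝒢J_Rᴴ‖ ≤ CJ·η`, `CJ := CQ + 4d·Cst` (from `𝒢′ − J𝒢Jᴴ = (1 − Π)𝒢′ + Π𝒢′(1 − Π) + (Π𝒢′Π − J𝒢Jᴴ)`), and the INJECTED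
   defect **`opNorm_calG_mul_JK_sub_le`**: `‖𝒢′J_R − J_R𝒢‖ ≤ CJ·η` (`e₁`).
 * §3 along the tower `n_k = L^k` (`idx`, `Qlev`, `calGlev`, `Jpc` of the lineage): `calDalev k = Δ_a^{(L^{−k})}` with
   `(calDalev k)⁻¹ = calGlev k` (`B5Prop11Inverse.calG_eq_inv`), `IsUnit (calDalev k).det`, `‖(calDalev k)⁻¹‖ ≤ Cst`, the pairing
   `√(L^d)·Q_L J_k = 1`, and the two defects as geometric sequences `2d·Cst·L^{−k}`, `CJ·L^{−k}`.

HONEST FRAMING (T4-DAG p. 1).  `U = 1`, FIXED finite torus, linear layer, operator norm; rate, pairing and constants OURS (Bałaban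
prints no η-rate; King's (4.38) is the scalar template); nothing printed is a hypothesis; NOT infinite volume / mass gap / Clay /
summit progress; spine 0/9 unchanged.  HONEST DEPENDENCY: continuum YM on T⁴ ⇐ BetaPertH ∧ nine spine estimates (0/9 proved);
BetaPertH ⇐ (D1) ∧ (D4) ∧ CAP+tail; G-an2-4 gates asym, D1 and NE2/3/4.  ABSOLUTE RULE kept; no `sorry`.
-/

noncomputable section

open scoped BigOperators ComplexConjugate Matrix Matrix.Norms.L2Operator

namespace Summit.QuantumFields.BalabanUV.T4Continuum.KingPairingPlantedLaw

open Literature.MathematicalPhysics.QuantumFieldTheory.Balaban1983to89.B5Prop11Plancherel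
open Literature.MathematicalPhysics.QuantumFieldTheory.Balaban1983to89.B5Prop11Inverse (calDa calDa_mul_calG calG_mul_calDa
  calG_eq_inv)
open Literature.MathematicalPhysics.QuantumFieldTheory.Balaban1983to89.B5G183RateTorus (CT_nonneg)
open Literature.MathematicalPhysics.QuantumFieldTheory.Balaban1983to89.B5G183RateTorusW
open Literature.MathematicalPhysics.QuantumFieldTheory.Balaban1983to89.B5G183RateUnitTower (lev lev_neZero)
open Summit.QuantumFields.BalabanUV.T4Continuum.BalabanBlockPoincare (Pi opNorm_one_sub_Pi_mul_le opNorm_shiftM_sub_one_mul_le)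
open Summit.QuantumFields.BalabanUV.T4Continuum.BalabanAveragedTowerUnit (idx Qlev calGlev one_le_lev' cast_lev'
  opNorm_Qlev_sq_le)
open Summit.QuantumFields.BalabanUV.T4Continuum.BalabanMinimizerLaw (Jpc Jpc_conjTranspose_mul_Jpc opNorm_Jpc_le)

variable {d : ℕ}

/-! ## §1 King's pairing as a two-level isometric injection -/

section TwoLevel

variable (N R : ℕ) [NeZero N] [NeZero R] (M : Fin d → ℕ) [hM : ∀ μ, NeZero (M μ)]

/-- **KING's PAIRING INJECTION** `J_R = R^{d/2}·Q_Rᴴ : ℓ²(T_η; ℂ^d) → ℓ²(T_{η/R}; ℂ^d)` (piecewise-constant extension over the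
`R`-blocks, isometrically normalised): «When x′ ∈ T_{η′}, we denote by x that point in T_η for which x′ ∈ B^n(x)».
[cite: King1986, p.664 (convention before Prop. 3.8), (2.10) p.653] [folklore] -/
def JK : Matrix (Tor (fine (R * N) M) × Fin d) (Tor (fine N M) × Fin d) ℂ :=
  (((Real.sqrt ((R : ℝ) ^ d)) : ℝ) : ℂ) • (Qavg N R M)ᴴ

omit [NeZero N] [NeZero R] hM in
/-- the real scalar `√(R^d)` is self-conjugate and squares to `R^d` in `ℂ`. [folklore] -/
theorem sqrt_facts : star ((((Real.sqrt ((R : ℝ) ^ d)) : ℝ) : ℂ)) = (((Real.sqrt ((R : ℝ) ^ d)) : ℝ) : ℂ) ∧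
    ((((Real.sqrt ((R : ℝ) ^ d)) : ℝ) : ℂ)) * (((Real.sqrt ((R : ℝ) ^ d)) : ℝ) : ℂ) = (R : ℂ) ^ d := by
  refine ⟨Complex.conj_ofReal _, ?_⟩
  rw [← Complex.ofReal_mul, Real.mul_self_sqrt (pow_nonneg (Nat.cast_nonneg _) d)]
  push_cast; rfl

/-- `J_Rᴴ J_R = 1` (the `R`-blocks tile the finer torus: `Q_R Q_Rᴴ = R^{−d}`). [cite: King1986, (2.10) p.653] [folklore] -/
theorem JK_conjTranspose_mul_JK : (JK N R M)ᴴ * JK N R M = 1 := by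
  have hRc : ((R : ℂ) ^ d) ≠ 0 := pow_ne_zero _ (by exact_mod_cast NeZero.ne R)
  obtain ⟨hs, hss⟩ := sqrt_facts (d := d) R
  rw [JK, Matrix.conjTranspose_smul, Matrix.conjTranspose_conjTranspose, hs, Matrix.smul_mul, Matrix.mul_smul, smul_smul,
    hss, Qavg_mul_conjTranspose, smul_smul, mul_inv_cancel₀ hRc, one_smul]

omit [NeZero R] in
/-- `J_R J_Rᴴ = Π`, the block-mean projector `R^d Q_RᴴQ_R` of `BalabanBlockPoincare`. [folklore] -/
theorem JK_mul_conjTranspose : JK N R M * (JK N R M)ᴴ = Pi N R M := by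
  obtain ⟨hs, hss⟩ := sqrt_facts (d := d) R
  rw [JK, Matrix.conjTranspose_smul, Matrix.conjTranspose_conjTranspose, hs, Matrix.smul_mul, Matrix.mul_smul, smul_smul,
    hss]
  rfl

/-- `‖J_R‖ ≤ 1`. [folklore] -/
theorem opNorm_JK_le : ‖JK N R M‖ ≤ 1 := by
  have hR : (0 : ℝ) < (R : ℝ) ^ d := pow_pos (by exact_mod_cast Nat.pos_of_ne_zero (NeZero.ne R)) d
  have hs0 : 0 < Real.sqrt ((R : ℝ) ^ d) := Real.sqrt_pos.mpr hR
  rw [JK, norm_smul, Complex.norm_real, Real.norm_of_nonneg hs0.le, Matrix.l2_opNorm_conjTranspose]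
  calc Real.sqrt ((R : ℝ) ^ d) * ‖Qavg N R M‖ ≤ Real.sqrt ((R : ℝ) ^ d) * (Real.sqrt ((R : ℝ) ^ d))⁻¹ :=
        mul_le_mul_of_nonneg_left (opNorm_Qavg_le N R M) hs0.le
    _ = 1 := mul_inv_cancel₀ hs0.ne'

/-- **THE PAIRING IS EXACT for King's block averaging**: `R^{d/2}·Q_R J_R = 1` — averaging the piecewise-constant extension returns
the coarse field (pairing defect `F = 0`). [cite: King1986, (2.10) p.653] [folklore] -/
theorem sqrt_smul_Qavg_mul_JK : ((((Real.sqrt ((R : ℝ) ^ d)) : ℝ) : ℂ)) • (Qavg N R M * JK N R M) = 1 := by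
  have hRc : ((R : ℂ) ^ d) ≠ 0 := pow_ne_zero _ (by exact_mod_cast NeZero.ne R)
  obtain ⟨_, hss⟩ := sqrt_facts (d := d) R
  rw [JK, Matrix.mul_smul, smul_smul, hss, Qavg_mul_conjTranspose, smul_smul, mul_inv_cancel₀ hRc, one_smul]

omit [NeZero R] in
/-- `Πᴴ = Π`. [folklore] -/
theorem Pi_conjTranspose : (Pi N R M)ᴴ = Pi N R M := by
  rw [← JK_mul_conjTranspose, Matrix.conjTranspose_mul, Matrix.conjTranspose_conjTranspose]

/-- `‖Π‖ ≤ 1`. [folklore] -/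
theorem opNorm_Pi_le : ‖Pi N R M‖ ≤ 1 := by
  rw [← JK_mul_conjTranspose]
  calc ‖JK N R M * (JK N R M)ᴴ‖ ≤ ‖JK N R M‖ * ‖(JK N R M)ᴴ‖ := Matrix.l2_opNorm_mul _ _
    _ ≤ 1 * 1 := by
        rw [Matrix.l2_opNorm_conjTranspose]
        exact mul_le_mul (opNorm_JK_le N R M) (opNorm_JK_le N R M) (norm_nonneg _) zero_le_one
    _ = 1 := one_mul 1

/-! ## §2 The planted law w.r.t. King's pairing at `U = 1`, and its two defects -/

variable (a : ℝ) (ha : 0 < a)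

/-- **`‖(1 − Π)𝒢^{(η/R)}‖ ≤ 2d·Cst·η`** — block Poincaré with the axis defects `‖(S^ν − 1)𝒢′‖ ≤ Cst/(RN)` of (1.89).
[cite: Balaban1984PropagatorsI, Prop. 1.1 (1.89) p.33; King1986, (2.10) p.653] [folklore] -/
theorem opNorm_one_sub_Pi_mul_calG_le (hN : 1 ≤ N) (hRN : 1 ≤ R * N) :
    ‖(1 - Pi N R M) * calG (R * N) hRN M a ha‖ ≤ 2 * d * Cst d a / N := by
  have hNpos : (0 : ℝ) < N := by exact_mod_cast hN
  have hRpos : (0 : ℝ) < R := by exact_mod_cast Nat.pos_of_ne_zero (NeZero.ne R)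
  have hc : (((R * N : ℕ) : ℂ)) ≠ 0 := by exact_mod_cast (Nat.pos_iff_ne_zero.mp hRN)
  have hcn : ‖(((R * N : ℕ) : ℂ))‖ = (R : ℝ) * N := by rw [Complex.norm_natCast]; push_cast; ring
  have hCst := Cst_nonneg d a
  have hX : ∀ ν, ‖(shiftM (fine (R * N) M) ν - 1) * calG (R * N) hRN M a ha‖ ≤ Cst d a / ((R : ℝ) * N) := by
    intro ν
    have h := opNorm_shiftM_sub_one_mul_le (calG (R * N) hRN M a ha) hc ν (opNorm_fdiff_calG_le (R * N) hRN M a ha ν)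
    rwa [hcn] at h
  have hδ : 0 ≤ Cst d a / ((R : ℝ) * N) := by positivity
  refine (opNorm_one_sub_Pi_mul_le N R M _ hδ hX).trans (le_of_eq ?_)
  field_simp

/-- **THE COMPLEMENT DEFECT `e₀`**: `‖𝒢^{(η/R)}(1 − Π)‖ ≤ 2d·Cst·η` (adjoint of the previous; `𝒢′`, `Π` Hermitian), with
`1 − Π = 1 − J_RJ_Rᴴ`. [cite: Balaban1984PropagatorsI, Prop. 1.1 (1.89) p.33] [folklore] -/
theorem opNorm_calG_mul_one_sub_Pi_le (hN : 1 ≤ N) (hRN : 1 ≤ R * N) :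
    ‖calG (R * N) hRN M a ha * (1 - JK N R M * (JK N R M)ᴴ)‖ ≤ 2 * d * Cst d a / N := by
  have e : calG (R * N) hRN M a ha * (1 - JK N R M * (JK N R M)ᴴ) = ((1 - Pi N R M) * calG (R * N) hRN M a ha)ᴴ := by
    rw [JK_mul_conjTranspose, Matrix.conjTranspose_mul, Matrix.conjTranspose_sub, Matrix.conjTranspose_one, Pi_conjTranspose,
      (calG_isHermitian (R * N) hRN M a ha).eq]
  rw [e, Matrix.l2_opNorm_conjTranspose]
  exact opNorm_one_sub_Pi_mul_calG_le N R M a ha hN hRN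

/-- **`‖Π𝒢′Π − J_R𝒢J_Rᴴ‖ ≤ CQ·η`**: `Π𝒢′Π − J_R𝒢J_Rᴴ = J_R·(R^dQ_R𝒢′Q_Rᴴ − 𝒢)·J_Rᴴ` and the King law
`‖Q_R𝒢′Q_Rᴴ − R^{−d}𝒢‖ ≤ R^{−d}CQ·η` (`B5G183RateTorusW.opNorm_Qavg_calG_rate`). [cite: King1986, (2.10) p.653, Lemma 4.5 (4.38) p.674;
Balaban1984PropagatorsI, (1.83) p.31, Prop. 1.1 (1.89) p.33] [folklore] -/
theorem opNorm_Pi_calG_Pi_sub_planted_le (hN : 1 ≤ N) (hR : 1 ≤ R) (hRN : 1 ≤ R * N) :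
    ‖Pi N R M * calG (R * N) hRN M a ha * Pi N R M - JK N R M * calG N hN M a ha * (JK N R M)ᴴ‖ ≤ CQ d a / N := by
  have hRd : (0 : ℝ) < (R : ℝ) ^ d := pow_pos (by exact_mod_cast Nat.pos_of_ne_zero (NeZero.ne R)) d
  have hRc : ((R : ℂ) ^ d) ≠ 0 := pow_ne_zero _ (by exact_mod_cast NeZero.ne R)
  obtain ⟨hs, hss⟩ := sqrt_facts (d := d) R
  set G' := calG (R * N) hRN M a ha
  set G := calG N hN M a ha
  set Q := Qavg N R M
  -- `Π 𝒢′ Π − J 𝒢 Jᴴ = J (Jᴴ𝒢′J − 𝒢) Jᴴ` and `Jᴴ𝒢′J = R^d Q𝒢′Qᴴ`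
  have e1 : Pi N R M * G' * Pi N R M - JK N R M * G * (JK N R M)ᴴ
      = JK N R M * ((JK N R M)ᴴ * G' * JK N R M - G) * (JK N R M)ᴴ := by
    rw [← JK_mul_conjTranspose, Matrix.mul_sub, Matrix.sub_mul]
    simp only [Matrix.mul_assoc]
  have e2 : (JK N R M)ᴴ * G' * JK N R M = ((R : ℂ) ^ d) • (Q * G' * Qᴴ) := by
    rw [JK, Matrix.conjTranspose_smul, Matrix.conjTranspose_conjTranspose, hs, Matrix.smul_mul, Matrix.smul_mul,
      Matrix.mul_smul, smul_smul, hss]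
  rw [e1, e2]
  have hJ := opNorm_JK_le N R M
  have hJ' : ‖(JK N R M)ᴴ‖ ≤ 1 := by rw [Matrix.l2_opNorm_conjTranspose]; exact hJ
  have hK := opNorm_Qavg_calG_rate N R M hN hR hRN a ha
  have hK' : ‖((R : ℂ) ^ d) • (Q * G' * Qᴴ) - G‖ ≤ CQ d a / N := by
    have e2 : ((R : ℂ) ^ d) • (Q * G' * Qᴴ) - G = ((R : ℂ) ^ d) • (Q * G' * Qᴴ - ((R : ℂ) ^ d)⁻¹ • G) := by
      rw [smul_sub, smul_smul, mul_inv_cancel₀ hRc, one_smul]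
    rw [e2, norm_smul, norm_pow, Complex.norm_natCast]
    calc (R : ℝ) ^ d * ‖Q * G' * Qᴴ - ((R : ℂ) ^ d)⁻¹ • G‖ ≤ (R : ℝ) ^ d * (((R : ℝ) ^ d)⁻¹ * CQ d a / N) :=
          mul_le_mul_of_nonneg_left hK hRd.le
      _ = CQ d a / N := by field_simp
  have h0 : 0 ≤ CQ d a / N := (norm_nonneg _).trans hK'
  calc ‖JK N R M * (((R : ℂ) ^ d) • (Q * G' * Qᴴ) - G) * (JK N R M)ᴴ‖
      ≤ ‖JK N R M * (((R : ℂ) ^ d) • (Q * G' * Qᴴ) - G)‖ * ‖(JK N R M)ᴴ‖ := Matrix.l2_opNorm_mul _ _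
    _ ≤ ‖JK N R M‖ * ‖((R : ℂ) ^ d) • (Q * G' * Qᴴ) - G‖ * ‖(JK N R M)ᴴ‖ :=
        mul_le_mul_of_nonneg_right (Matrix.l2_opNorm_mul _ _) (norm_nonneg _)
    _ ≤ 1 * (CQ d a / N) * 1 := mul_le_mul (mul_le_mul hJ hK' (norm_nonneg _) zero_le_one) hJ' (norm_nonneg _) (by positivity)
    _ = CQ d a / N := by ring

omit [NeZero N] [NeZero R] hM in
/-- the constant of the planted law w.r.t. King's pairing: `CJ = CQ + 4d·Cst`; OURS. [folklore] -/
def CJ (d : ℕ) (a : ℝ) : ℝ := CQ d a + 4 * d * Cst d a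

omit [NeZero N] [NeZero R] hM in
/-- `0 ≤ CJ`. [folklore] -/
theorem CJ_nonneg (d : ℕ) (a : ℝ) : 0 ≤ CJ d a := by
  have h1 : 0 ≤ CQ d a := by
    have := CT_nonneg d a; have := Cst_nonneg d a; rw [CQ]; positivity
  have := Cst_nonneg d a
  rw [CJ]; positivity

/-- **THE `U = 1` PLANTED LAW W.R.T. KING's PAIRING** (finite torus, all `N, R ≥ 1`, `a > 0`, every `d`):
`‖𝒢^{(η/R)} − J_R 𝒢^{(η)} J_Rᴴ‖ ≤ CJ(d,a)·η` — the finer free propagator IS the piecewise-constantly planted coarser one up to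
`O(η)` in operator norm.  From `𝒢′ − J𝒢Jᴴ = (1 − Π)𝒢′ + Π𝒢′(1 − Π) + (Π𝒢′Π − J𝒢Jᴴ)`.  Statement, pairing and constant OURS.
[cite: King1986, p.664, (2.10) p.653, Lemma 4.5 (4.38) p.674; Balaban1984PropagatorsI, (1.83) p.31, Prop. 1.1 (1.89) p.33] [folklore] -/
theorem opNorm_calG_sub_planted_le (hN : 1 ≤ N) (hR : 1 ≤ R) (hRN : 1 ≤ R * N) :
    ‖calG (R * N) hRN M a ha - JK N R M * calG N hN M a ha * (JK N R M)ᴴ‖ ≤ CJ d a / N := by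
  set G' := calG (R * N) hRN M a ha
  set P0 := Pi N R M
  have e : G' - JK N R M * calG N hN M a ha * (JK N R M)ᴴ
      = (1 - P0) * G' + P0 * (G' * (1 - JK N R M * (JK N R M)ᴴ))
        + (P0 * G' * P0 - JK N R M * calG N hN M a ha * (JK N R M)ᴴ) := by
    rw [JK_mul_conjTranspose, Matrix.sub_mul, Matrix.one_mul, Matrix.mul_sub, Matrix.mul_one, Matrix.mul_sub,
      ← Matrix.mul_assoc P0 G' P0]
    abel
  rw [e]
  have h1 := opNorm_one_sub_Pi_mul_calG_le N R M a ha hN hRN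
  have h2 := opNorm_calG_mul_one_sub_Pi_le N R M a ha hN hRN
  have h3 := opNorm_Pi_calG_Pi_sub_planted_le N R M a ha hN hR hRN
  have hPi := opNorm_Pi_le N R M
  have h2' : ‖P0 * (G' * (1 - JK N R M * (JK N R M)ᴴ))‖ ≤ 2 * d * Cst d a / N :=
    (Matrix.l2_opNorm_mul _ _).trans ((mul_le_mul hPi h2 (norm_nonneg _) zero_le_one).trans (le_of_eq (one_mul _)))
  calc _ ≤ ‖(1 - P0) * G' + P0 * (G' * (1 - JK N R M * (JK N R M)ᴴ))‖
          + ‖P0 * G' * P0 - JK N R M * calG N hN M a ha * (JK N R M)ᴴ‖ := norm_add_le _ _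
    _ ≤ (‖(1 - P0) * G'‖ + ‖P0 * (G' * (1 - JK N R M * (JK N R M)ᴴ))‖)
          + ‖P0 * G' * P0 - JK N R M * calG N hN M a ha * (JK N R M)ᴴ‖ := add_le_add (norm_add_le _ _) le_rfl
    _ ≤ (2 * d * Cst d a / N + 2 * d * Cst d a / N) + CQ d a / N := add_le_add (add_le_add h1 h2') h3
    _ = CJ d a / N := by rw [CJ]; ring

/-- **THE INJECTED DEFECT `e₁`**: `‖𝒢^{(η/R)} J_R − J_R 𝒢^{(η)}‖ ≤ CJ(d,a)·η` (`= (𝒢′ − J𝒢Jᴴ)·J`, `JᴴJ = 1`). [cite: King1986,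
p.664, Lemma 4.5 (4.38) p.674; Balaban1984PropagatorsI, Prop. 1.1 (1.89) p.33] [folklore] -/
theorem opNorm_calG_mul_JK_sub_le (hN : 1 ≤ N) (hR : 1 ≤ R) (hRN : 1 ≤ R * N) :
    ‖calG (R * N) hRN M a ha * JK N R M - JK N R M * calG N hN M a ha‖ ≤ CJ d a / N := by
  have e : calG (R * N) hRN M a ha * JK N R M - JK N R M * calG N hN M a ha
      = (calG (R * N) hRN M a ha - JK N R M * calG N hN M a ha * (JK N R M)ᴴ) * JK N R M := by
    rw [Matrix.sub_mul, Matrix.mul_assoc (JK N R M * calG N hN M a ha), JK_conjTranspose_mul_JK, Matrix.mul_one]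
  rw [e]
  calc _ ≤ ‖calG (R * N) hRN M a ha - JK N R M * calG N hN M a ha * (JK N R M)ᴴ‖ * ‖JK N R M‖ := Matrix.l2_opNorm_mul _ _
    _ ≤ CJ d a / N * 1 := mul_le_mul (opNorm_calG_sub_planted_le N R M a ha hN hR hRN) (opNorm_JK_le N R M) (norm_nonneg _)
        (div_nonneg (CJ_nonneg d a) (Nat.cast_nonneg N))
    _ = CJ d a / N := mul_one _

end TwoLevel

/-! ## §3 The `U = 1` inputs along the tower `n_k = L^k` -/

section TowerLevel

variable (L : ℕ) [NeZero L] (M : Fin d → ℕ) [hM : ∀ μ, NeZero (M μ)] (a : ℝ) (ha : 0 < a)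

/-- King's pairing along the tower, TYPED between consecutive tower index sets `idx k → idx (k+1)` (the lineage's `Jpc k`, whose
target index `Tor (fine (L·n_k) M)` is definitionally `idx (k+1)`). [cite: King1986, p.664 (convention before Prop. 3.8)] [folklore] -/
def JpcT (k : ℕ) : Matrix (idx L M (k + 1)) (idx L M k) ℂ := Jpc L M k

omit [NeZero L] hM in
/-- `JpcT k` is the two-level injection at `(N, R) = (L^k, L)` (definitional). [folklore] -/
theorem JpcT_eq_JK (k : ℕ) : JpcT L M k = JK (lev L k) L M := rfl

/-- `J_kᴴ J_k = 1` along the tower. [cite: King1986, (2.10) p.653] [folklore] -/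
theorem JpcT_conjTranspose_mul_JpcT (k : ℕ) : (JpcT L M k)ᴴ * JpcT L M k = 1 := JK_conjTranspose_mul_JK (lev L k) L M

/-- `‖J_k‖ ≤ 1` along the tower. [folklore] -/
theorem opNorm_JpcT_le (k : ℕ) : ‖JpcT L M k‖ ≤ 1 := opNorm_JK_le (lev L k) L M

/-- Bałaban's `Δ_a` ((1.69)/(1.73)) at spacing `L^{−k}`, the free operator of level `k`. [cite: Balaban1984PropagatorsI, (1.69) p.29,
(1.73) p.30] -/
def calDalev (k : ℕ) : Matrix (idx L M k) (idx L M k) ℂ := calDa (lev L k) (one_le_lev' L k) M a ha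

/-- `(Δ_a^{(k)})⁻¹ = 𝒢^{(k)}` (b05's `calG_eq_inv`). [cite: Balaban1984PropagatorsI, (1.71) p.30, (1.82)-(1.83) p.31] -/
theorem calDalev_inv (k : ℕ) : (calDalev L M a ha k)⁻¹ = calGlev L M a ha k :=
  (calG_eq_inv (lev L k) (one_le_lev' L k) M a ha).symm

/-- `Δ_a^{(k)}` is invertible. [cite: Balaban1984PropagatorsI, (1.73) p.30] -/
theorem isUnit_det_calDalev (k : ℕ) : IsUnit (calDalev L M a ha k).det :=
  Matrix.isUnit_det_of_right_inverse (calDa_mul_calG (lev L k) (one_le_lev' L k) M a ha)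

/-- `‖(Δ_a^{(k)})⁻¹‖ ≤ Cst` — (1.89), order zero. [cite: Balaban1984PropagatorsI, Prop. 1.1 (1.89) p.33] -/
theorem opNorm_inv_calDalev_le (k : ℕ) : ‖(calDalev L M a ha k)⁻¹‖ ≤ Cst d a := by
  rw [calDalev_inv]; exact opNorm_calG_le (lev L k) (one_le_lev' L k) M a ha

/-- the pairing along the tower: `√(L^d)·Q_L J_k = 1 + 0`. [cite: King1986, (2.10) p.653] [folklore] -/
theorem sqrt_smul_Qlev_mul_JpcT (k : ℕ) :
    ((((Real.sqrt ((L : ℝ) ^ d)) : ℝ) : ℂ)) • (Qlev L M k * JpcT L M k) = 1 + 0 := by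
  rw [add_zero]; exact sqrt_smul_Qavg_mul_JK (lev L k) L M

/-- the complement defect along the tower: `‖𝒢^{(k+1)}(1 − J_kJ_kᴴ)‖ ≤ 2d·Cst·L^{−k}`. [cite: Balaban1984PropagatorsI, Prop. 1.1
(1.89) p.33] [folklore] -/
theorem complement_le_lev (k : ℕ) :
    ‖(calDalev L M a ha (k + 1))⁻¹ * (1 - JpcT L M k * (JpcT L M k)ᴴ)‖ ≤ 2 * d * Cst d a * ((L : ℝ)⁻¹) ^ k := by
  have h := opNorm_calG_mul_one_sub_Pi_le (lev L k) L M a ha (one_le_lev' L k) (one_le_lev' L (k + 1))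
  rw [cast_lev'] at h
  rw [inv_pow, ← div_eq_mul_inv, calDalev_inv]
  exact h

/-- the injected defect along the tower: `‖𝒢^{(k+1)}J_k − J_k𝒢^{(k)}‖ ≤ CJ·L^{−k}`. [cite: King1986, p.664, Lemma 4.5 (4.38) p.674;
Balaban1984PropagatorsI, Prop. 1.1 (1.89) p.33] [folklore] -/
theorem injected_le_lev (k : ℕ) :
    ‖(calDalev L M a ha (k + 1))⁻¹ * JpcT L M k - JpcT L M k * (calDalev L M a ha k)⁻¹‖ ≤ CJ d a * ((L : ℝ)⁻¹) ^ k := by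
  have hL1 : 1 ≤ L := Nat.pos_of_ne_zero (NeZero.ne L)
  have h := opNorm_calG_mul_JK_sub_le (lev L k) L M a ha (one_le_lev' L k) hL1 (one_le_lev' L (k + 1))
  rw [cast_lev'] at h
  rw [inv_pow, ← div_eq_mul_inv, calDalev_inv, calDalev_inv]
  exact h

end TowerLevel

end Summit.QuantumFields.BalabanUV.T4Continuum.KingPairingPlantedLaw

end
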